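import Literature.AlgebraicGeometry.Frobenioids.PadicFrobenioidPrimitive
import HarnessLib

/-!
# Frobenioids II, Example 1.1 (ii): the `p`-adic Frobenioid of a monoprime subfunctor `Φ ⊆ Φ₀|_D` (generic construction)

Mochizuki, *The geometry of Frobenioids II*, Kyushu J. Math. **62** (2008) 401–460, §1, Example 1.1 (ii), p. 8
[cite: MochizukiFrdII2008, Ex 1.1 (ii) p.8]:

> "Let `D` be any connected, totally epimorphic category that admits a functor `D → D₀`, and `Φ ⊆ Φ₀^Λ|_D` a
> monoprime [cf. [FrdI], §0] subfunctor in monoids [such that] the image of the resulting homomorphism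
> `B := B₀|_D ×_{Φ₀^gp|_D} Φ^gp → Φ^gp` is nonzero … we obtain a Frobenioid `C`, which we shall refer to as
> a *`p`-adic Frobenioid*. … [author's 2019 comment (9),(10): `Φ₀^ℤ := Φ₀`, `B₀^ℤ := B₀`.]"

`PadicFrobenioid.lean` (abc-iut-L1-t4) types this as the record `PadicFrd.Datum` (with `B`, the square and its
cartesianness as fields). This file performs, ONCE, the construction "`Φ ↦ (Φ, ι, B := B₀|_D ×_{Φ₀^gp} Φ^gp)`"
for an arbitrary objectwise submonoid family `S_A ⊆ Φ₀(A) = ord(O_{K_A}^⊳) ⊗ ℝ_{≥0}` stable under the pull-back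
maps (`SubDatum`: `S`, stability, monoprimality, and a non-unit `g_A ∈ O_{K_A}^⊳` with `ord(g_A) ⊗ 1 ∈ S_A`
witnessing "nonzero"):

* `SubDatum.Φ`, `SubDatum.ι` (injective), `SubDatum.B` (the fibre product as an equaliser submonoid of
  `K_A^× × (Φ(A))^gp`), `SubDatum.toB0`, `SubDatum.divB`, `SubDatum.lift`;
* `SubDatum.toDatum T hloc hc he : Datum D p` — cartesian by construction, nonzero on the lift of `g`.

Instances: the perfection `ord(O^⊳)^pf` ([IUTchI] Ex. 3.3 (i) `Φ_{C_v}`, `PadicFrobenioidPerfection.lean`); the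
monogenic / absolutely primitive data of `PadicFrobenioidMonogenic.lean` / `PadicFrobenioidPrimitive.lean` are the
cases `S = ℤ_{≥0} · ord(c)`, `ℤ_{≥0} · ord(p)` (constructed there directly). No statement of the paper is strengthened.
-/

noncomputable section

namespace Literature.AlgebraicGeometry.Frobenioids

namespace PadicFrd

open CategoryTheory Opposite Function ValuativeRel

universe v u

variable {D : Type u} [Category.{v} D] {p : ℕ} (base : D ⥤ PadicFld.{u} p)

/-- The data of a "monoprime subfunctor in monoids `Φ ⊆ Φ₀|_D`" with nonzero `B → Φ^gp` (FrdII Ex. 1.1 (ii)),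
given objectwise: submonoids `S_A ⊆ Φ₀(A)` stable under the pull-back maps of `Φ₀|_D`, each monoprime, and a
non-unit `g_A ∈ O_{K_A}^⊳` with `ord(g_A) ⊗ 1 ∈ S_A` (so that the lift of `g_A` to `B(A)` has nonzero divisor).
[cite: MochizukiFrdII2008, Ex 1.1 (ii) p.8] -/
structure SubDatum where
  /-- `Φ(A) ⊆ Φ₀(A)` -/
  S : ∀ A : D, Submonoid (Realification (OrdInt (base.obj A).K))
  /-- stability under the pull-back maps of `Φ₀|_D` (a subfunctor) -/
  map_mem : ∀ {A A' : Dᵒᵖ} (f : A ⟶ A') (x : Realification (OrdInt (base.obj A.unop).K)),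
    x ∈ S A.unop → phi0Map base f x ∈ S A'.unop
  /-- `Φ(A)` is monoprime -/
  isMonoprime : ∀ A : D, IsMonoprime (S A)
  /-- a non-unit of `O_{K_A}^⊳` whose class lies in `Φ(A)` -/
  g : ∀ A : D, intNonzero (base.obj A).K
  /-- `ord(g_A) ⊗ 1 ∈ Φ(A)` -/
  g_mem : ∀ A : D, Realification.of (OrdInt (base.obj A).K) (Associates.mk (g A)) ∈ S A
  /-- `g_A` is not a unit (positive valuation) -/
  g_not_isUnit : ∀ A : D, ¬ IsUnit (g A)

namespace SubDatum

variable {base} (T : SubDatum base)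

/-! ### The subfunctor `Φ` and its inclusion -/

/-- The pull-back map of `Φ` along `f` (in `Dᵒᵖ`): the restriction of that of `Φ₀|_D`.
[cite: MochizukiFrdII2008, Ex 1.1 (ii) p.8] -/
def ΦMap {A A' : Dᵒᵖ} (f : A ⟶ A') : T.S A.unop →* T.S A'.unop :=
  ((phi0Map base f).restrict (T.S A.unop)).codRestrict _ fun x => T.map_mem f x.1 x.2

/-- The value of the pull-back map of `Φ`. [cite: MochizukiFrdII2008, Ex 1.1 (ii) p.8] -/
@[simp] theorem coe_ΦMap {A A' : Dᵒᵖ} (f : A ⟶ A') (x : T.S A.unop) :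
    (T.ΦMap f x : Realification (OrdInt (base.obj A'.unop).K)) = phi0Map base f x.1 := rfl

/-- **`Φ ⊆ Φ₀|_D`** as a functor `Dᵒᵖ → CommMon`. [cite: MochizukiFrdII2008, Ex 1.1 (ii) p.8] -/
def Φ : Dᵒᵖ ⥤ CommMonCat.{u} where
  obj A := CommMonCat.of (T.S A.unop)
  map f := CommMonCat.ofHom (T.ΦMap f)
  map_id A := by
    apply CommMonCat.hom_ext
    refine MonoidHom.ext fun x => Subtype.ext ?_
    show phi0Map base (𝟙 A) x.1 = x.1
    rw [phi0Map_id]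
    rfl
  map_comp f g := by
    apply CommMonCat.hom_ext
    refine MonoidHom.ext fun x => Subtype.ext ?_
    show phi0Map base (f ≫ g) x.1 = phi0Map base g (phi0Map base f x.1)
    rw [phi0Map_comp]
    rfl

/-- The inclusion `ι : Φ ↪ Φ₀|_D`. [cite: MochizukiFrdII2008, Ex 1.1 (ii) p.8] -/
def ι : T.Φ ⟶ phiZeroOn base where
  app A := CommMonCat.ofHom (Submonoid.subtype _)
  naturality {A A'} f := by
    apply CommMonCat.hom_ext
    exact MonoidHom.ext fun x => rfl

/-- `ι` is objectwise injective. [cite: MochizukiFrdII2008, Ex 1.1 (ii) p.8] -/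
theorem ι_injective (A : Dᵒᵖ) : Injective (T.ι.app A).hom := Subtype.val_injective

/-! ### The fibre product `B := B₀|_D ×_{Φ₀^gp|_D} Φ^gp` -/

/-- `B(A) ⊆ K_A^× × (Φ(A))^gp`: the pairs `(x, γ)` with `Div₀(x) = ι^gp(γ)`. [cite: MochizukiFrdII2008, Ex 1.1 (ii) p.8] -/
def BSub (A : Dᵒᵖ) : Submonoid ((bZeroOn base).obj A × Algebra.GrothendieckGroup (T.Φ.obj A)) :=
  MonoidHom.eqLocusM (((divZeroOn base).app A).hom.comp (MonoidHom.fst _ _))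
    (((Functor.whiskerRight T.ι MonGp.functor).app A).hom.comp (MonoidHom.snd _ _))

/-- Membership in `B(A)`. [cite: MochizukiFrdII2008, Ex 1.1 (ii) p.8] -/
theorem mem_BSub_iff (A : Dᵒᵖ) (q : (bZeroOn base).obj A × Algebra.GrothendieckGroup (T.Φ.obj A)) :
    q ∈ T.BSub A ↔
      ((divZeroOn base).app A).hom q.1 = ((Functor.whiskerRight T.ι MonGp.functor).app A).hom q.2 :=
  Iff.rfl

/-- The pull-back map of `B` along `f`: `(x, γ) ↦ (B₀(f)(x), Φ^gp(f)(γ))`. [cite: MochizukiFrdII2008, Ex 1.1 (ii) p.8] -/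
def BMap {A A' : Dᵒᵖ} (f : A ⟶ A') : T.BSub A →* T.BSub A' :=
  ((MonoidHom.prodMap ((bZeroOn base).map f).hom ((monoidGp T.Φ).map f).hom).comp
    (Submonoid.subtype _)).codRestrict _ fun q => by
    obtain ⟨⟨x, γ⟩, hq⟩ := q
    have hq' : ((divZeroOn base).app A).hom x = ((Functor.whiskerRight T.ι MonGp.functor).app A).hom γ := hq
    have n1 := congrArg (fun φ => φ.hom x) ((divZeroOn base).naturality f)
    have n2 := congrArg (fun φ => φ.hom γ) ((Functor.whiskerRight T.ι MonGp.functor).naturality f)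
    simp only [CommMonCat.hom_comp, MonoidHom.comp_apply] at n1 n2
    show ((divZeroOn base).app A').hom (((bZeroOn base).map f).hom x) =
      ((Functor.whiskerRight T.ι MonGp.functor).app A').hom (((monoidGp T.Φ).map f).hom γ)
    exact n1.trans ((congrArg ((monoidGp (phiZeroOn base)).map f).hom hq').trans n2.symm)

/-- **`B := B₀|_D ×_{Φ₀^gp|_D} Φ^gp`** as a functor `Dᵒᵖ → CommMon`. [cite: MochizukiFrdII2008, Ex 1.1 (ii) p.8] -/
def B : Dᵒᵖ ⥤ CommMonCat.{u} where
  obj A := CommMonCat.of (T.BSub A)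
  map f := CommMonCat.ofHom (T.BMap f)
  map_id A := by
    apply CommMonCat.hom_ext
    refine MonoidHom.ext fun q => Subtype.ext (Prod.ext ?_ ?_)
    · exact (DFunLike.congr_fun (congrArg CommMonCat.Hom.hom ((bZeroOn base).map_id A)) q.1.1).trans rfl
    · exact (DFunLike.congr_fun (congrArg CommMonCat.Hom.hom ((monoidGp T.Φ).map_id A)) q.1.2).trans rfl
  map_comp f g := by
    apply CommMonCat.hom_ext
    refine MonoidHom.ext fun q => Subtype.ext (Prod.ext ?_ ?_)
    · exact (DFunLike.congr_fun (congrArg CommMonCat.Hom.hom ((bZeroOn base).map_comp f g)) q.1.1).trans rfl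
    · exact (DFunLike.congr_fun (congrArg CommMonCat.Hom.hom ((monoidGp T.Φ).map_comp f g)) q.1.2).trans rfl

/-- The first projection `B → B₀|_D` ("`u ↦ u|_{K^×}`"). [cite: MochizukiFrdII2008, Ex 1.1 (ii) p.8] -/
def toB0 : T.B ⟶ bZeroOn base where
  app A := CommMonCat.ofHom ((MonoidHom.fst _ _).comp (Submonoid.subtype _))
  naturality {A A'} f := by
    apply CommMonCat.hom_ext
    exact MonoidHom.ext fun q => rfl

/-- The second projection `Div_B : B → Φ^gp`. [cite: MochizukiFrdII2008, Ex 1.1 (ii) p.8] -/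
def divB : T.B ⟶ monoidGp T.Φ where
  app A := CommMonCat.ofHom ((MonoidHom.snd _ _).comp (Submonoid.subtype _))
  naturality {A A'} f := by
    apply CommMonCat.hom_ext
    exact MonoidHom.ext fun q => rfl

/-- The lift of `g_A ∈ K_A^×` to `B(A)`, over `(g_A, ord(g_A) ⊗ 1)`. [cite: MochizukiFrdII2008, Ex 1.1 (ii) p.8] -/
def lift (A : Dᵒᵖ) : T.BSub A :=
  ⟨(intNonzeroToUnits (base.obj A.unop).K (T.g A.unop),
    Algebra.GrothendieckGroup.of (⟨_, T.g_mem A.unop⟩ : T.S A.unop)), by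
    rw [mem_BSub_iff]
    change divZeroHom (base.obj A.unop).K (intNonzeroToUnits _ _) =
      MonGp.map (T.ι.app A).hom (Algebra.GrothendieckGroup.of _)
    rw [divZeroHom_intNonzeroToUnits, MonGp.map_of]
    rfl⟩

/-! ### The datum -/

section PadicLocal

variable [Fact p.Prime]

/-- `ord(g_A) ⊗ 1 ≠ 1` (`g_A` is a non-unit; `ord(O_K^⊳) → Φ₀` is injective for a `p`-adic local field,
abc-iut-L1-d10). [cite: MochizukiFrdII2008, Ex 1.1 (i) p.7] -/
theorem of_g_ne_one {A : D} (hloc : (base.obj A).IsPadicLocal) :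
    Realification.of (OrdInt (base.obj A).K) (Associates.mk (T.g A)) ≠ 1 := by
  obtain ⟨⟨inst, hfin, hc⟩⟩ := hloc
  letI := inst
  haveI := hfin
  intro h
  have h2 : Associates.mk (T.g A) = 1 := Realification.of_injective (isMonoprime_ordInt hc) (h.trans (map_one _).symm)
  rw [Associates.mk_eq_one] at h2
  exact T.g_not_isUnit A h2

/-- **The `p`-adic Frobenioid datum of the subfunctor `Φ ⊆ Φ₀|_D`** (FrdII Ex. 1.1 (ii)): base a category of
`p`-adic local fields (`hloc`), connected, totally epimorphic; `Φ` monoprime; `B := B₀|_D ×_{Φ₀^gp} Φ^gp`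
cartesian by construction; `Div_B` nonzero on the lift of `g`. [cite: MochizukiFrdII2008, Ex 1.1 (ii) p.8] -/
def toDatum (hloc : ∀ A : D, (base.obj A).IsPadicLocal) (hc : IsConnected D) (he : IsTotallyEpimorphic D) :
    Datum D p where
  base := base
  isPadicLocal := hloc
  isConnected_base := hc
  isTotallyEpimorphic_base := he
  Φ := T.Φ
  ι := T.ι
  ι_injective := T.ι_injective
  isMonoprime A := T.isMonoprime A.unop
  B := T.B
  toB0 := T.toB0
  divB := T.divB
  square := by
    refine NatTrans.ext (funext fun A => ?_)
    rw [NatTrans.comp_app, NatTrans.comp_app]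
    apply CommMonCat.hom_ext
    rw [CommMonCat.hom_comp, CommMonCat.hom_comp]
    exact MonoidHom.ext fun q => q.2
  cartesian A := by
    constructor
    · intro b b' h
      exact Subtype.ext (congrArg Subtype.val h)
    · rintro ⟨q, hq⟩
      exact ⟨⟨q, hq⟩, rfl⟩
  nonzero A := by
    refine ⟨T.lift A, fun h => T.of_g_ne_one (hloc A.unop) ?_⟩
    haveI := isCancelMul_realification (OrdInt (base.obj A.unop).K)
    have h1 : Algebra.GrothendieckGroup.of (⟨_, T.g_mem A.unop⟩ : T.S A.unop) = 1 := h
    have h2 := congrArg (MonGp.map (T.S A.unop).subtype) h1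
    rw [MonGp.map_of, map_one, Submonoid.subtype_apply] at h2
    exact Algebra.GrothendieckGroup.of_injective (h2.trans (map_one _).symm)

/-- The pull-back maps of `B` are injective (an element of `B(A)` is determined by its `K^×`-component, `ι^gp`
being injective). [cite: MochizukiFrdII2008, Ex 1.1 (ii) p.8] -/
theorem toDatum_map_B_injective (hloc : ∀ A : D, (base.obj A).IsPadicLocal) (hc : IsConnected D)
    (he : IsTotallyEpimorphic D) {A A' : D} (g : A' ⟶ A) :
    Injective ((T.toDatum hloc hc he).B.map g.op).hom := by
  intro b b' h
  have h1 : Units.map ((base.map g).alg : (base.obj A).K →* (base.obj A').K) b.1.1 =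
      Units.map ((base.map g).alg : (base.obj A).K →* (base.obj A').K) b'.1.1 :=
    congrArg (fun q : T.BSub (op A') => q.1.1) h
  have hx : b.1.1 = b'.1.1 :=
    Units.map_injective (f := ((base.map g).alg : (base.obj A).K →* (base.obj A').K)) (base.map g).alg.injective h1
  haveI : IsCancelMul ((phiZeroOn base).obj (op A)) := isCancelMul_realification (OrdInt (base.obj A).K)
  have hι : Injective (MonGp.map (T.ι.app (op A)).hom) := MonGp.map_injective _ (T.ι_injective _)
  have hγ : b.1.2 = b'.1.2 := by
    apply hι
    have hb : ((divZeroOn base).app (op A)).hom b.1.1 = MonGp.map (T.ι.app (op A)).hom b.1.2 := b.2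
    have hb' : ((divZeroOn base).app (op A)).hom b'.1.1 = MonGp.map (T.ι.app (op A)).hom b'.1.2 := b'.2
    rw [← hb, ← hb', hx]
  exact Subtype.ext (Prod.ext hx hγ)

end PadicLocal

end SubDatum

end PadicFrd

end Literature.AlgebraicGeometry.Frobenioids
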